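import Mathlib
import Literature.AlgebraicGeometry.Resolution.FieldsJ2
import Literature.AlgebraicGeometry.Resolution.LocalBlowup
import Literature.AlgebraicGeometry.Resolution.AffineDomainDimension
import Literature.AlgebraicGeometry.CossartPiltant200819.Cor46Cofinality2008
import Summits.ResolutionOfSingularities.ResolutionOfSingularities.Theorems.RadicialJungCleanModelsCleanLU3ArcPackage
import HarnessLib

/-!
# Regular affine model for clean local uniformization in dimension 2

Steps 1-4a of stub_cleanLU2: given a regular centre of dimension 2, shrink to a regular
affine model A₁ = Ā[f⁻¹] ⊆ Ō with the required properties.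

SESSION: res-B-cdiv-w3 g1 (restructured per B-lead TAKING (split) 2026-08-29T09:19:11Z).
-/

noncomputable section

set_option linter.dupNamespace false

open IsLocalRing AlgebraicGeometry CategoryTheory TopologicalSpace
open Literature.AlgebraicGeometry.Resolution
open Literature.AlgebraicGeometry.CossartPiltant200819.CP2008

namespace Summit.ResolutionOfSingularities.ResolutionOfSingularities.Theorems.RadicialJung.CleanModels

/-- **Regular affine model for clean LU2 (Steps 1-4a).**
Given a finitely generated k-subalgebra Ā ⊆ Ō with regular centre of dimension 2,
produce A₁ = Ā[f⁻¹] ⊆ Ō with: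
- A₁.toSubring ≤ Ō.toSubring
- Ā ≤ A₁
- A₁.FG
- IsFractionRing A₁ κ
- IsRegularRing A₁
- ringKrullDim A₁ ≤ 2

This is the input to cleanLU2_of_regularAffineModel (lead's theorem, Steps 5-9).
[cite: Giraud1983, Thm. 2.4] [cite: StacksProject, Tag 0BIC] -/
theorem exists_regularAffineModel_of_regularAtCentre
    (p : ℕ) (_hp : p.Prime) (k : Type) [Field k] [CharP k p] (κ : Type) [Field κ] [Algebra k κ]
    (Ō : ValuationSubring κ) (Ā : Subalgebra k κ)
    (hĀŌ : Ā.toSubring ≤ Ō.toSubring) (hĀfg : Ā.FG) (hfrac : IsFractionRing Ā κ)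
    (hreg : IsRegularLocalRing (locAtCentre Ā.toSubring Ō))
    (hdim : ringKrullDim (locAtCentre Ā.toSubring Ō) = 2)
    (hzd : ∀ (T : Subring κ) (hT : T ≤ Ō.toSubring), Ā.toSubring ≤ T → (subringCentre T Ō hT).IsMaximal) :
    ∃ (A₁ : Subalgebra k κ),
      A₁.toSubring ≤ Ō.toSubring ∧
      Ā ≤ A₁ ∧
      A₁.FG ∧
      IsFractionRing A₁ κ ∧
      IsRegularRing A₁ ∧
      ringKrullDim A₁ ≤ 2 := by
  haveI : Fact p.Prime := ⟨_hp⟩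
  haveI : IsFractionRing Ā κ := hfrac

  -- Step 1: Dimension of Ā equals 2
  have hdimĀ : ringKrullDim Ā = 2 := by
    rw [← ringKrullDim_locAtCentre_eq_of_isMaximal Ā hĀfg Ō hĀŌ (hzd _ hĀŌ le_rfl)]
    exact hdim

  -- Step 2: The regular locus of Spec Ā is open (J-2 for fields)
  haveI : Algebra.FiniteType k Ā := Ā.fg_iff_finiteType.mp hĀfg
  have hregOpen : IsOpen (regularLocus Ā) := isOpen_regularLocus_of_finiteType_field k Ā

  -- Step 2a: The centre lies in the regular locus
  let 𝔮 := subringCentre Ā.toSubring Ō hĀŌ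
  haveI : 𝔮.IsPrime := subringCentre.isPrime Ā.toSubring Ō hĀŌ

  have hreg_loc : IsRegularLocalRing (Localization.AtPrime 𝔮) := by
    rw [← isRegularLocalRing_locAtCentre_iff hĀŌ]
    exact hreg

  -- Step 2b: The centre as a PrimeSpectrum point lies in the regular locus
  let P : PrimeSpectrum Ā := ⟨𝔮, inferInstance⟩
  have hPreg : P ∈ regularLocus Ā := by
    rw [mem_regularLocus]
    exact hreg_loc

  -- Step 3: Find a basic open D(f) around the centre inside the regular locus
  haveI : IsNoetherianRing Ā := Algebra.FiniteType.isNoetherianRing k Ā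
  obtain ⟨U, ⟨f, rfl⟩, hfP, hfU⟩ :=
    PrimeSpectrum.isTopologicalBasis_basic_opens.exists_subset_of_mem_open hPreg hregOpen
  have hf𝔮 : f ∉ 𝔮 := hfP

  -- Step 3a: f has valuation 1 (is a unit in Ō)
  have hvf : Ō.valuation (f : κ) = 1 := by
    have hle : Ō.valuation (f : κ) ≤ 1 := Ō.valuation_le_one ⟨f, hĀŌ f.2⟩
    have hnlt : ¬ Ō.valuation (f : κ) < 1 := fun hlt => by
      apply hf𝔮
      rw [mem_subringCentre_iff]
      exact hlt
    exact le_antisymm hle (not_lt.mp hnlt)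

  have hf0 : (f : κ) ≠ 0 := by
    intro h
    rw [h, map_zero] at hvf
    exact zero_ne_one hvf

  -- Step 3b: Build A₁ = Ā[f⁻¹] which is regular
  have hfinvO : (f : κ)⁻¹ ∈ Ō := by
    rw [← ValuationSubring.valuation_le_one_iff, map_inv₀, hvf, inv_one]

  -- Get the generating set s₀ from hĀfg
  obtain ⟨s₀, rfl⟩ := hĀfg

  -- A₁ = Algebra.adjoin k (insert f⁻¹ s₀)
  let s₁ : Set κ := insert (f : κ)⁻¹ (s₀ : Set κ)
  let A₁ := Algebra.adjoin k s₁

  have hle : Algebra.adjoin k (s₀ : Set κ) ≤ A₁ := Algebra.adjoin_mono (Set.subset_insert _ _)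

  -- A₁ ⊆ Ō
  have hA₁Ō : A₁.toSubring ≤ Ō.toSubring := by
    have h1 : A₁ ≤ { carrier := (Ō : Set κ)
                     mul_mem' := fun ha hb => Ō.toSubring.mul_mem ha hb
                     one_mem' := Ō.toSubring.one_mem
                     add_mem' := fun ha hb => Ō.toSubring.add_mem ha hb
                     zero_mem' := Ō.toSubring.zero_mem
                     algebraMap_mem' := fun c => hĀŌ ((Algebra.adjoin k (s₀ : Set κ)).algebraMap_mem c) } := by
      refine Algebra.adjoin_le ?_
      rintro z (rfl | hz)
      · exact hfinvO
      · exact hĀŌ (Algebra.subset_adjoin hz)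
    exact fun z hz => h1 hz

  haveI hfr₁ : IsFractionRing A₁ κ := isFractionRing_of_le hle hfrac

  have hA₁fg : A₁.FG := by
    haveI := Classical.typeDecidableEq κ
    refine ⟨Insert.insert (f : κ)⁻¹ s₀, ?_⟩
    simp only [Finset.coe_insert]
    rfl

  haveI : Algebra.FiniteType k A₁ := A₁.fg_iff_finiteType.mp hA₁fg
  haveI hNR₁ : IsNoetherianRing A₁ := Algebra.FiniteType.isNoetherianRing k A₁

  -- Apply isRegularRing_adjoin_insert_inv to show A₁ is regular
  have hregA₁ : IsRegularRing A₁ := by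
    have hfsub : (f : κ) ∈ Algebra.adjoin k (s₀ : Set κ) := f.2
    let f₀ : Algebra.adjoin k (s₀ : Set κ) := ⟨f, hfsub⟩
    have hf₀coe : (f₀ : κ) = (f : κ) := rfl
    have hfU' : (PrimeSpectrum.basicOpen f₀ : Set (PrimeSpectrum (Algebra.adjoin k (s₀ : Set κ)))) ⊆
        regularLocus (Algebra.adjoin k (s₀ : Set κ)) := hfU
    exact isRegularRing_adjoin_insert_inv (s₀ : Set κ) f₀ hf0 hfU'

  -- Step 4a: Dimension of A₁ ≤ 2
  have hA₁dim : ringKrullDim A₁ ≤ 2 := by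
    have htrdeg_κ : Algebra.trdeg k κ = 2 := by
      rw [trdeg_eq_trdeg_of_isFractionRing (Algebra.adjoin k (s₀ : Set κ))]
      obtain ⟨n, hn, htr⟩ := exists_ringKrullDim_eq_and_trdeg_eq k (Algebra.adjoin k (s₀ : Set κ))
      rw [hdimĀ] at hn
      have hn2 : n = 2 := by cases hn; rfl
      rw [hn2] at htr
      exact htr
    exact ringKrullDim_le_of_fg_of_trdeg_le A₁ hA₁fg (le_of_eq htrdeg_κ)

  exact ⟨A₁, hA₁Ō, hle, hA₁fg, hfr₁, hregA₁, hA₁dim⟩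

end Summit.ResolutionOfSingularities.ResolutionOfSingularities.Theorems.RadicialJung.CleanModels

end
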